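import Mathlib.Tactic.Ring
import Mathlib.Data.Real.Basic
import HarnessLib

/-!
# Conjecture N (hodge-weil ladder, GAPS G51b/G51c), format (5,3): THE PURITY-PRESERVING FLOW `A ↦ A + t·u`

Prover 2, generation 15 (note `run/shared/lean/b2b/hodge-weil/b2b-hweil-pv2-g15/DIVIDED-DIFFERENCE-G15.md` §2.5). Setting of `CONJECTURE-N.md` §1
in format (5,3) (E-roots `(A_e,u_e)`, F-roots `(B_g,v_g)`; purity sums `P1 = ΣεA²u`, `P2 = ΣεAu²`, `P4 = Σεu³`; `Q₂`, `Q₄`). Shifting every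
POSITION by `t` times its own CHARGE, `(A_e, B_g) ↦ (A_e + tu_e, B_g + tv_g)`, is a one-parameter flow on configurations which (i) preserves
centring of positions when the charges are centred, (ii) maps `P1 ↦ P1 + 2t·P2 + t²·P4`, `P2 ↦ P2 + t·P4` and fixes `P4`, hence PRESERVES THE PURE
LOCUS, (iii) fixes `Q₄` and moves `Q₂` along the parabola `Q₂(t) = Q₂ + t·(3S_uS_{Au} − 6S_{u³A}) + t²·(−Q₄)` — convex when `Q₄ < 0` — while
pairwise ampleness `|u_e − v_g| ≤ (A_e − B_g) + t(u_e − v_g)` holds exactly on a closed interval of `t` containing `0`. CONSEQUENCE (the FLOW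
REDUCTION of the note, §2.5/§4.4): to prove `Q₂ + λQ₄ ≥ 0` on pure pairwise-ample configurations with `Q₄ < 0` it suffices to treat those that
minimise `Q₂` on their ampleness interval — either `3S_uS_{Au} − 6S_{u³A} = 0` (equivalently `c₁ := 12S_{u³A} − 6S_uS_{Au} = 0`) or one more
E–F pair is null-separated. The identities below are the kernel part ((ii), (iii)); they are polynomial identities with no hypothesis. Nothing here
is a case of HC, a rung or a door edge; no statement of Markman's papers is used. New cell result ⇒ Summits/.
-/

set_option linter.dupNamespace false

namespace Summit.HodgeConjecture.HodgeConjecture.WeilClassTestFormatFiveThreeFlow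

/-- The flow `A ↦ A + tu` on (P1): `P1(A + tu) = P1 + 2t·P2 + t²·P4` (format (5,3)). -/
theorem flow_P1 (A₁ A₂ A₃ A₄ A₅ B₁ B₂ B₃ u₁ u₂ u₃ u₄ u₅ v₁ v₂ v₃ t : ℝ) :
    ((A₁ + t * u₁) ^ 2 * u₁ + (A₂ + t * u₂) ^ 2 * u₂ + (A₃ + t * u₃) ^ 2 * u₃ + (A₄ + t * u₄) ^ 2 * u₄ + (A₅ + t * u₅) ^ 2 * u₅) - ((B₁ + t * v₁) ^ 2 * v₁ + (B₂ + t * v₂) ^ 2 * v₂ + (B₃ + t * v₃) ^ 2 * v₃)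
      = ((A₁ ^ 2 * u₁ + A₂ ^ 2 * u₂ + A₃ ^ 2 * u₃ + A₄ ^ 2 * u₄ + A₅ ^ 2 * u₅) - (B₁ ^ 2 * v₁ + B₂ ^ 2 * v₂ + B₃ ^ 2 * v₃)) + 2 * t * ((A₁ * u₁ ^ 2 + A₂ * u₂ ^ 2 + A₃ * u₃ ^ 2 + A₄ * u₄ ^ 2 + A₅ * u₅ ^ 2) - (B₁ * v₁ ^ 2 + B₂ * v₂ ^ 2 + B₃ * v₃ ^ 2)) + t ^ 2 * ((u₁ ^ 3 + u₂ ^ 3 + u₃ ^ 3 + u₄ ^ 3 + u₅ ^ 3) - (v₁ ^ 3 + v₂ ^ 3 + v₃ ^ 3)) := by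
  ring

/-- The flow `A ↦ A + tu` on (P2): `P2(A + tu) = P2 + t·P4` (format (5,3)). -/
theorem flow_P2 (A₁ A₂ A₃ A₄ A₅ B₁ B₂ B₃ u₁ u₂ u₃ u₄ u₅ v₁ v₂ v₃ t : ℝ) :
    ((A₁ + t * u₁) * u₁ ^ 2 + (A₂ + t * u₂) * u₂ ^ 2 + (A₃ + t * u₃) * u₃ ^ 2 + (A₄ + t * u₄) * u₄ ^ 2 + (A₅ + t * u₅) * u₅ ^ 2) - ((B₁ + t * v₁) * v₁ ^ 2 + (B₂ + t * v₂) * v₂ ^ 2 + (B₃ + t * v₃) * v₃ ^ 2)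
      = ((A₁ * u₁ ^ 2 + A₂ * u₂ ^ 2 + A₃ * u₃ ^ 2 + A₄ * u₄ ^ 2 + A₅ * u₅ ^ 2) - (B₁ * v₁ ^ 2 + B₂ * v₂ ^ 2 + B₃ * v₃ ^ 2)) + t * ((u₁ ^ 3 + u₂ ^ 3 + u₃ ^ 3 + u₄ ^ 3 + u₅ ^ 3) - (v₁ ^ 3 + v₂ ^ 3 + v₃ ^ 3)) := by
  ring

/-- The flow `A ↦ A + tu` on `Q₂`: `Q₂(A + tu) = Q₂ + t·(3S_uS_{Au} − 6S_{u³A}) + t²·(−Q₄)` (format (5,3); `Q₄` itself does not move).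
The linear coefficient is `−c₁/2` (`c₁` of `WeilClassTestFormatFiveThreeProductFormula.c1_eq_dd12`), the quadratic one is `−Q₄ = Q₂(u; u)`. -/
theorem flow_Q2 (A₁ A₂ A₃ A₄ A₅ B₁ B₂ B₃ u₁ u₂ u₃ u₄ u₅ v₁ v₂ v₃ t : ℝ) :
    (1 / 2) * (((A₁ + t * u₁) ^ 2 + (A₂ + t * u₂) ^ 2 + (A₃ + t * u₃) ^ 2 + (A₄ + t * u₄) ^ 2 + (A₅ + t * u₅) ^ 2) - ((B₁ + t * v₁) ^ 2 + (B₂ + t * v₂) ^ 2 + (B₃ + t * v₃) ^ 2)) * ((u₁ ^ 2 + u₂ ^ 2 + u₃ ^ 2 + u₄ ^ 2 + u₅ ^ 2) - (v₁ ^ 2 + v₂ ^ 2 + v₃ ^ 2))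
        + (((A₁ + t * u₁) * u₁ + (A₂ + t * u₂) * u₂ + (A₃ + t * u₃) * u₃ + (A₄ + t * u₄) * u₄ + (A₅ + t * u₅) * u₅) - ((B₁ + t * v₁) * v₁ + (B₂ + t * v₂) * v₂ + (B₃ + t * v₃) * v₃)) ^ 2
        - 3 * (((A₁ + t * u₁) ^ 2 * u₁ ^ 2 + (A₂ + t * u₂) ^ 2 * u₂ ^ 2 + (A₃ + t * u₃) ^ 2 * u₃ ^ 2 + (A₄ + t * u₄) ^ 2 * u₄ ^ 2 + (A₅ + t * u₅) ^ 2 * u₅ ^ 2) - ((B₁ + t * v₁) ^ 2 * v₁ ^ 2 + (B₂ + t * v₂) ^ 2 * v₂ ^ 2 + (B₃ + t * v₃) ^ 2 * v₃ ^ 2))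
      = ((1 / 2) * ((A₁ ^ 2 + A₂ ^ 2 + A₃ ^ 2 + A₄ ^ 2 + A₅ ^ 2) - (B₁ ^ 2 + B₂ ^ 2 + B₃ ^ 2)) * ((u₁ ^ 2 + u₂ ^ 2 + u₃ ^ 2 + u₄ ^ 2 + u₅ ^ 2) - (v₁ ^ 2 + v₂ ^ 2 + v₃ ^ 2))
        + ((A₁ * u₁ + A₂ * u₂ + A₃ * u₃ + A₄ * u₄ + A₅ * u₅) - (B₁ * v₁ + B₂ * v₂ + B₃ * v₃)) ^ 2
        - 3 * ((A₁ ^ 2 * u₁ ^ 2 + A₂ ^ 2 * u₂ ^ 2 + A₃ ^ 2 * u₃ ^ 2 + A₄ ^ 2 * u₄ ^ 2 + A₅ ^ 2 * u₅ ^ 2) - (B₁ ^ 2 * v₁ ^ 2 + B₂ ^ 2 * v₂ ^ 2 + B₃ ^ 2 * v₃ ^ 2)))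
        + t * (3 * ((u₁ ^ 2 + u₂ ^ 2 + u₃ ^ 2 + u₄ ^ 2 + u₅ ^ 2) - (v₁ ^ 2 + v₂ ^ 2 + v₃ ^ 2)) * ((A₁ * u₁ + A₂ * u₂ + A₃ * u₃ + A₄ * u₄ + A₅ * u₅) - (B₁ * v₁ + B₂ * v₂ + B₃ * v₃)) - 6 * ((u₁ ^ 3 * A₁ + u₂ ^ 3 * A₂ + u₃ ^ 3 * A₃ + u₄ ^ 3 * A₄ + u₅ ^ 3 * A₅) - (v₁ ^ 3 * B₁ + v₂ ^ 3 * B₂ + v₃ ^ 3 * B₃)))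
        + t ^ 2 * (-(3 * ((u₁ ^ 4 + u₂ ^ 4 + u₃ ^ 4 + u₄ ^ 4 + u₅ ^ 4) - (v₁ ^ 4 + v₂ ^ 4 + v₃ ^ 4)) - (3 / 2) * ((u₁ ^ 2 + u₂ ^ 2 + u₃ ^ 2 + u₄ ^ 2 + u₅ ^ 2) - (v₁ ^ 2 + v₂ ^ 2 + v₃ ^ 2)) ^ 2)) := by
  ring

/-- `G_λ` along the flow: `Q₂(A + tu) + λQ₄ = (Q₂ + λQ₄) + t·(3S_uS_{Au} − 6S_{u³A}) + t²·(−Q₄)`; for `Q₄ < 0` a convex parabola in `t` with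
vertex at `t* = (3S_uS_{Au} − 6S_{u³A})/(2Q₄)`, whose position relative to the ampleness interval decides the flow reduction. -/
theorem flow_Glam (A₁ A₂ A₃ A₄ A₅ B₁ B₂ B₃ u₁ u₂ u₃ u₄ u₅ v₁ v₂ v₃ t l : ℝ) :
    (1 / 2) * (((A₁ + t * u₁) ^ 2 + (A₂ + t * u₂) ^ 2 + (A₃ + t * u₃) ^ 2 + (A₄ + t * u₄) ^ 2 + (A₅ + t * u₅) ^ 2) - ((B₁ + t * v₁) ^ 2 + (B₂ + t * v₂) ^ 2 + (B₃ + t * v₃) ^ 2)) * ((u₁ ^ 2 + u₂ ^ 2 + u₃ ^ 2 + u₄ ^ 2 + u₅ ^ 2) - (v₁ ^ 2 + v₂ ^ 2 + v₃ ^ 2))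
        + (((A₁ + t * u₁) * u₁ + (A₂ + t * u₂) * u₂ + (A₃ + t * u₃) * u₃ + (A₄ + t * u₄) * u₄ + (A₅ + t * u₅) * u₅) - ((B₁ + t * v₁) * v₁ + (B₂ + t * v₂) * v₂ + (B₃ + t * v₃) * v₃)) ^ 2
        - 3 * (((A₁ + t * u₁) ^ 2 * u₁ ^ 2 + (A₂ + t * u₂) ^ 2 * u₂ ^ 2 + (A₃ + t * u₃) ^ 2 * u₃ ^ 2 + (A₄ + t * u₄) ^ 2 * u₄ ^ 2 + (A₅ + t * u₅) ^ 2 * u₅ ^ 2) - ((B₁ + t * v₁) ^ 2 * v₁ ^ 2 + (B₂ + t * v₂) ^ 2 * v₂ ^ 2 + (B₃ + t * v₃) ^ 2 * v₃ ^ 2))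
      + l * (3 * ((u₁ ^ 4 + u₂ ^ 4 + u₃ ^ 4 + u₄ ^ 4 + u₅ ^ 4) - (v₁ ^ 4 + v₂ ^ 4 + v₃ ^ 4)) - (3 / 2) * ((u₁ ^ 2 + u₂ ^ 2 + u₃ ^ 2 + u₄ ^ 2 + u₅ ^ 2) - (v₁ ^ 2 + v₂ ^ 2 + v₃ ^ 2)) ^ 2)
      = (((1 / 2) * ((A₁ ^ 2 + A₂ ^ 2 + A₃ ^ 2 + A₄ ^ 2 + A₅ ^ 2) - (B₁ ^ 2 + B₂ ^ 2 + B₃ ^ 2)) * ((u₁ ^ 2 + u₂ ^ 2 + u₃ ^ 2 + u₄ ^ 2 + u₅ ^ 2) - (v₁ ^ 2 + v₂ ^ 2 + v₃ ^ 2))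
        + ((A₁ * u₁ + A₂ * u₂ + A₃ * u₃ + A₄ * u₄ + A₅ * u₅) - (B₁ * v₁ + B₂ * v₂ + B₃ * v₃)) ^ 2
        - 3 * ((A₁ ^ 2 * u₁ ^ 2 + A₂ ^ 2 * u₂ ^ 2 + A₃ ^ 2 * u₃ ^ 2 + A₄ ^ 2 * u₄ ^ 2 + A₅ ^ 2 * u₅ ^ 2) - (B₁ ^ 2 * v₁ ^ 2 + B₂ ^ 2 * v₂ ^ 2 + B₃ ^ 2 * v₃ ^ 2))) + l * (3 * ((u₁ ^ 4 + u₂ ^ 4 + u₃ ^ 4 + u₄ ^ 4 + u₅ ^ 4) - (v₁ ^ 4 + v₂ ^ 4 + v₃ ^ 4)) - (3 / 2) * ((u₁ ^ 2 + u₂ ^ 2 + u₃ ^ 2 + u₄ ^ 2 + u₅ ^ 2) - (v₁ ^ 2 + v₂ ^ 2 + v₃ ^ 2)) ^ 2))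
        + t * (3 * ((u₁ ^ 2 + u₂ ^ 2 + u₃ ^ 2 + u₄ ^ 2 + u₅ ^ 2) - (v₁ ^ 2 + v₂ ^ 2 + v₃ ^ 2)) * ((A₁ * u₁ + A₂ * u₂ + A₃ * u₃ + A₄ * u₄ + A₅ * u₅) - (B₁ * v₁ + B₂ * v₂ + B₃ * v₃)) - 6 * ((u₁ ^ 3 * A₁ + u₂ ^ 3 * A₂ + u₃ ^ 3 * A₃ + u₄ ^ 3 * A₄ + u₅ ^ 3 * A₅) - (v₁ ^ 3 * B₁ + v₂ ^ 3 * B₂ + v₃ ^ 3 * B₃)))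
        + t ^ 2 * (-(3 * ((u₁ ^ 4 + u₂ ^ 4 + u₃ ^ 4 + u₄ ^ 4 + u₅ ^ 4) - (v₁ ^ 4 + v₂ ^ 4 + v₃ ^ 4)) - (3 / 2) * ((u₁ ^ 2 + u₂ ^ 2 + u₃ ^ 2 + u₄ ^ 2 + u₅ ^ 2) - (v₁ ^ 2 + v₂ ^ 2 + v₃ ^ 2)) ^ 2)) := by
  ring

end Summit.HodgeConjecture.HodgeConjecture.WeilClassTestFormatFiveThreeFlow
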